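import Summits.Schanuel.Schanuel.Theorems.RootDecomp1ELWTransport07
import Literature.NumberTheory.Transcendental.LindemannWeierstrassMeasureHolds

/-!
# RootDecomp1ELWTransport — part 10 (census-1 gen 18 BOOKKEEPING, critic VERDICT L2111 (B)(iii)): the binder
# `hLW : LWMeasure` of the lens-2 g39 «LW-PAIR NORM TRANSPORT CELL» DISCHARGED BY NAME

`RootDecomp1KHyper.LWMeasure` (Hyper04) is, by definition, the Literature statement of the Ably 1994 /
Lindemann–Weierstrass transcendence MEASURE, which is PROVED in the Literature library:
`Literature.NumberTheory.Transcendental.Ably1994_lindemannWeierstrass_measure_holds` (module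
`LindemannWeierstrassMeasureHolds`, sorry-free; its cone builds on the check farm since 2026-08-31 ≈ 16:15Z,
cf. `RootDecomp1BFactDischarge.lwMeasure_holds`).  This file re-issues the cell theorems of part 07 WITHOUT the
binder — one primed one-liner each, statement = the tree statement with `(hLW : LWMeasure)` removed, proof = the
tree theorem applied to the Literature theorem.  Consequence of record (critic L2111 (B)(iii)): `S` ITSELF holds on
the class `InLWClass` UNCONDITIONALLY (`schanuel_on_lwClass'`), and the 1E item cells `cell_25020'` / `cell_31409'` /
`cell_31410'` and the members `four_le_trdeg_zStar'` / `six_le_trdeg_zTwin3I'` are hypothesis-free tree theorems.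
A CITATION of the Literature theorem: no new mathematics, no credit claimed, booked cells stay booked as they were
(E-R18 (a), VERDICT L1909); rung 0 — nothing here proves Schanuel.
-/

namespace Summit.Schanuel.Schanuel.Theorems.RootDecomp1ELWTransport

open Complex
open Summit.Schanuel.Schanuel.Theorems.RootDecomp1KHyper (LWMeasure)
open Literature.NumberTheory.Transcendental (Ably1994_lindemannWeierstrass_measure_holds)

/-- **`S` ITSELF on the class `InLWClass`, at every length `n` — UNCONDITIONAL** (part 07's cell theorem with `hLW` discharged by the Literature theorem). -/
theorem schanuel_on_lwClass' : ∀ (n : ℕ) (z : Fin n → ℂ), LinearIndependent ℚ z →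
    InLWClass z →
      (n : Cardinal) ≤ Algebra.trdeg ℚ
        ↥(IntermediateField.adjoin ℚ (Set.range z ∪ Set.range (Complex.exp ∘ z))) :=
  schanuel_on_lwClass Ably1994_lindemannWeierstrass_measure_holds

/-- Item 25020 `DefectOneSchanuel` on the class `InLWClass` — UNCONDITIONAL (binders verbatim, one class line). -/
theorem cell_25020' : ∀ (n : ℕ) (z : Fin n → ℂ), LinearIndependent ℚ z →
    InLWClass z →
      (n : Cardinal) ≤ Algebra.trdeg ℚ
        ↥(IntermediateField.adjoin ℚ (Set.range z ∪ Set.range (Complex.exp ∘ z))) + 1 :=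
  cell_25020 Ably1994_lindemannWeierstrass_measure_holds

/-- Item 31409 `EStableDefectOne` on the class `InLWClass` — UNCONDITIONAL (binders verbatim, one class line). -/
theorem cell_31409' : ∀ (n : ℕ) (z : Fin n → ℂ), LinearIndependent ℚ z →
    (∃ β : ℂ, IsAlgebraic ℚ β ∧ β ∉ Set.range (algebraMap ℚ ℂ) ∧
      ∀ i, β * z i ∈ Submodule.span ℚ (Set.range z)) →
    (∀ (m : ℕ) (w : Fin m → ℂ), m < n → LinearIndependent ℚ w →
      (∀ j, w j ∈ Submodule.span ℚ (Set.range z)) →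
        (m : Cardinal) ≤ Algebra.trdeg ℚ
          ↥(IntermediateField.adjoin ℚ (Set.range w ∪ Set.range (Complex.exp ∘ w))) + 1) →
    InLWClass z →
      (n : Cardinal) ≤ Algebra.trdeg ℚ
        ↥(IntermediateField.adjoin ℚ (Set.range z ∪ Set.range (Complex.exp ∘ z))) + 1 :=
  cell_31409 Ably1994_lindemannWeierstrass_measure_holds

/-- Item 31410 `PlainDefectOne` on the class `InLWClass` — UNCONDITIONAL (binders verbatim, one class line). -/
theorem cell_31410' : ∀ (n : ℕ) (z : Fin n → ℂ), LinearIndependent ℚ z →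
    (∀ β : ℂ, IsAlgebraic ℚ β → (∀ i, β * z i ∈ Submodule.span ℚ (Set.range z)) →
      β ∈ Set.range (algebraMap ℚ ℂ)) →
    (∀ (m : ℕ) (w : Fin m → ℂ), m < n → LinearIndependent ℚ w →
      (∀ j, w j ∈ Submodule.span ℚ (Set.range z)) →
        (m : Cardinal) ≤ Algebra.trdeg ℚ
          ↥(IntermediateField.adjoin ℚ (Set.range w ∪ Set.range (Complex.exp ∘ w))) + 1) →
    InLWClass z →
      (n : Cardinal) ≤ Algebra.trdeg ℚ
        ↥(IntermediateField.adjoin ℚ (Set.range z ∪ Set.range (Complex.exp ∘ z))) + 1 :=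
  cell_31410 Ably1994_lindemannWeierstrass_measure_holds

/-- `trdeg_ℚ ℚ(z₄, e^{z₄}) ≥ 4` at the credit member `z₄ = (T⋆, iT⋆, T⋆², iT⋆²)` — UNCONDITIONAL. -/
theorem four_le_trdeg_zStar' :
    (4 : Cardinal) ≤ Algebra.trdeg ℚ
      ↥(IntermediateField.adjoin ℚ (Set.range zStar ∪ Set.range (Complex.exp ∘ zStar))) :=
  four_le_trdeg_zStar Ably1994_lindemannWeierstrass_measure_holds

/-- `trdeg ≥ 6` at `(T⋆, T⋆², T⋆³, iT⋆, iT⋆², iT⋆³)` — UNCONDITIONAL. -/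
theorem six_le_trdeg_zTwin3I' :
    ((6 : ℕ) : Cardinal) ≤ Algebra.trdeg ℚ
      ↥(IntermediateField.adjoin ℚ (Set.range (zTwin 3 I Tstar) ∪
        Set.range (Complex.exp ∘ zTwin 3 I Tstar))) :=
  six_le_trdeg_zTwin3I Ably1994_lindemannWeierstrass_measure_holds

end Summit.Schanuel.Schanuel.Theorems.RootDecomp1ELWTransport
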